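import Mathlib.NumberTheory.ModularForms.Derivative
import Mathlib.Algebra.MvPolynomial.PDeriv
import HarnessLib

/-!
# Differentiating polynomial expressions in finitely many holomorphic functions on `ℍ`

A small algebraic engine for differential identities between (quasi-)modular forms: given
holomorphic `f₀, …, f_{n−1} : ℍ → ℂ` whose normalised derivatives `D = (2πi)⁻¹ d/dτ` (Mathlib's
`normalizedDerivOfComplex`), scaled by a constant `c`, are again polynomials in the `fᵢ`
(`c • D fᵢ = dᵢ(f)`, e.g. Ramanujan's system for `E₂, E₄, E₆`, or the level-6 system of the
four-step random walk), the scaled derivative of ANY polynomial expression `p(f)` is the polynomial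
`Σᵢ ∂ᵢp · dᵢ` evaluated at `f` (`smul_D_evalF`), so that iterated derivatives are computed inside
`MvPolynomial (Fin n) ℂ` (`Dpoly`), where `ring` decides the resulting identities.

## References

* D. Zagier, *Elliptic modular forms and their applications* (2008), §5.1 (quasimodular forms and
  derivatives; Ramanujan's system (Prop. 15)). [Zagier2008]
-/

noncomputable section

open UpperHalfPlane hiding I
open Complex MvPolynomial Derivative
open scoped Manifold

namespace Literature.NumberTheory.ModularForms

variable {n : ℕ}

/-- The function `τ ↦ p(f₀(τ), …, f_{n−1}(τ))`. [folklore] -/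
def evalF (f : Fin n → ℍ → ℂ) (p : MvPolynomial (Fin n) ℂ) : ℍ → ℂ :=
  fun τ => MvPolynomial.eval (fun i => f i τ) p

/-- Pointwise value. [folklore] -/
theorem evalF_apply (f : Fin n → ℍ → ℂ) (p : MvPolynomial (Fin n) ℂ) (τ : ℍ) :
    evalF f p τ = MvPolynomial.eval (fun i => f i τ) p := rfl

/-- `evalF` of a constant. [folklore] -/
@[simp] theorem evalF_C (f : Fin n → ℍ → ℂ) (a : ℂ) : evalF f (C a) = fun _ => a := by
  funext τ; simp [evalF]

/-- `evalF` of a variable. [folklore] -/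
@[simp] theorem evalF_X (f : Fin n → ℍ → ℂ) (i : Fin n) : evalF f (X i) = f i := by
  funext τ; simp [evalF]

/-- `evalF` is additive. [folklore] -/
@[simp] theorem evalF_add (f : Fin n → ℍ → ℂ) (p q : MvPolynomial (Fin n) ℂ) :
    evalF f (p + q) = evalF f p + evalF f q := by
  funext τ; simp [evalF]

/-- `evalF` is multiplicative. [folklore] -/
@[simp] theorem evalF_mul (f : Fin n → ℍ → ℂ) (p q : MvPolynomial (Fin n) ℂ) :
    evalF f (p * q) = evalF f p * evalF f q := by
  funext τ; simp [evalF]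

/-- `evalF` of a finite sum. [folklore] -/
theorem evalF_sum (f : Fin n → ℍ → ℂ) {ι : Type*} (s : Finset ι) (p : ι → MvPolynomial (Fin n) ℂ) :
    evalF f (∑ i ∈ s, p i) = ∑ i ∈ s, evalF f (p i) := by
  funext τ; simp [evalF, map_sum, Finset.sum_apply]

/-- Polynomial expressions in holomorphic functions are holomorphic. [folklore] -/
theorem mdifferentiable_evalF {f : Fin n → ℍ → ℂ} (hf : ∀ i, MDiff (f i)) (p : MvPolynomial (Fin n) ℂ) :
    MDiff (evalF f p) := by
  induction p using MvPolynomial.induction_on with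
  | C a => rw [evalF_C]; exact mdifferentiable_const
  | add p q hp hq => rw [evalF_add]; exact hp.add hq
  | mul_X p i hp => rw [evalF_mul, evalF_X]; exact hp.mul (hf i)

/-- The formal derivation on `ℂ[X₀,…,X_{n−1}]` determined by `Xᵢ ↦ dᵢ`:
`Dpoly d p = Σᵢ ∂ᵢp · dᵢ`. [folklore] -/
def Dpoly (d : Fin n → MvPolynomial (Fin n) ℂ) (p : MvPolynomial (Fin n) ℂ) : MvPolynomial (Fin n) ℂ :=
  ∑ i, pderiv i p * d i

/-- `Dpoly` kills constants. [folklore] -/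
@[simp] theorem Dpoly_C (d : Fin n → MvPolynomial (Fin n) ℂ) (a : ℂ) : Dpoly d (C a) = 0 := by
  simp [Dpoly]

/-- `Dpoly` on a variable. [folklore] -/
@[simp] theorem Dpoly_X (d : Fin n → MvPolynomial (Fin n) ℂ) (i : Fin n) : Dpoly d (X i) = d i := by
  simp [Dpoly, pderiv_X, Pi.single_apply]

/-- `Dpoly` is additive. [folklore] -/
theorem Dpoly_add (d : Fin n → MvPolynomial (Fin n) ℂ) (p q : MvPolynomial (Fin n) ℂ) :
    Dpoly d (p + q) = Dpoly d p + Dpoly d q := by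
  simp [Dpoly, add_mul, Finset.sum_add_distrib]

/-- Leibniz rule for `Dpoly`. [folklore] -/
theorem Dpoly_mul (d : Fin n → MvPolynomial (Fin n) ℂ) (p q : MvPolynomial (Fin n) ℂ) :
    Dpoly d (p * q) = Dpoly d p * q + p * Dpoly d q := by
  simp only [Dpoly, Derivation.leibniz, smul_eq_mul, Finset.mul_sum, Finset.sum_mul, ← Finset.sum_add_distrib]
  refine Finset.sum_congr rfl fun i _ => ?_
  ring

/-- `Dpoly` of a power. [folklore] -/
theorem Dpoly_pow (d : Fin n → MvPolynomial (Fin n) ℂ) (p : MvPolynomial (Fin n) ℂ) (k : ℕ) :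
    Dpoly d (p ^ (k + 1)) = (k + 1 : ℕ) * p ^ k * Dpoly d p := by
  induction k with
  | zero => simp
  | succ k ih =>
    rw [pow_succ, Dpoly_mul, ih]
    push_cast
    ring

/-- **The chain rule for polynomial expressions.** If `c • D fᵢ = dᵢ(f)` for all `i`, then
`c • D p(f) = (Σᵢ ∂ᵢp · dᵢ)(f)` for every polynomial `p`. [cite: Zagier2008, §5.1] -/
theorem smul_D_evalF {f : Fin n → ℍ → ℂ} (hf : ∀ i, MDiff (f i)) (c : ℂ)
    {d : Fin n → MvPolynomial (Fin n) ℂ} (hd : ∀ i, c • D (f i) = evalF f (d i))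
    (p : MvPolynomial (Fin n) ℂ) : c • D (evalF f p) = evalF f (Dpoly d p) := by
  induction p using MvPolynomial.induction_on with
  | C a =>
    rw [evalF_C, Dpoly_C, normalizedDerivOfComplex_const, smul_zero]
    funext τ; simp [evalF]
  | add p q hp hq =>
    rw [evalF_add, normalizedDerivOfComplex_add _ _ (mdifferentiable_evalF hf p) (mdifferentiable_evalF hf q),
      smul_add, hp, hq, Dpoly_add, evalF_add]
  | mul_X p i hp =>
    rw [evalF_mul, evalF_X, normalizedDerivOfComplex_mul _ _ (mdifferentiable_evalF hf p) (hf i),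
      smul_add, Dpoly_mul, Dpoly_X, evalF_add, evalF_mul, evalF_mul, evalF_X]
    have h1 : c • (D (evalF f p) * f i) = (c • D (evalF f p)) * f i := by
      funext τ; simp [smul_eq_mul, mul_assoc]
    have h2 : c • (evalF f p * D (f i)) = evalF f p * (c • D (f i)) := by
      funext τ; simp [smul_eq_mul]; ring
    rw [h1, h2, hp, hd i]

/-- Iterating: with `D_c := c • D`, `D_c^[k] p(f) = (Dpoly d)^[k] p (f)`. [folklore] -/
theorem smul_D_iterate_evalF {f : Fin n → ℍ → ℂ} (hf : ∀ i, MDiff (f i)) (c : ℂ)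
    {d : Fin n → MvPolynomial (Fin n) ℂ} (hd : ∀ i, c • D (f i) = evalF f (d i))
    (p : MvPolynomial (Fin n) ℂ) (k : ℕ) :
    (fun F : ℍ → ℂ => c • D F)^[k] (evalF f p) = evalF f ((Dpoly d)^[k] p) := by
  induction k generalizing p with
  | zero => rfl
  | succ k ih =>
    rw [Function.iterate_succ_apply, Function.iterate_succ_apply, smul_D_evalF hf c hd p, ih]

end Literature.NumberTheory.ModularForms

end
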